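import Mathlib
import Summits.Ventures.PercRepro2.MixChordOChords
import Summits.Ventures.PercRepro2.PendantRoot
import Summits.Ventures.PercRepro2.PendantO
import Summits.Ventures.PercRepro2.HCovSwap

/-!
# The `o`-class `D`-chord when `a₃` is a LEAF at a root or at `o` (blind cell PercRepro2,
night-1 g22; proofs/NIGHT1-G22.md §1–§2)

The `o`-class row of the chain of record (`DZ2ChordO_all`, the weakest chord, implied by the
`D`-chord `NMixChord normD`) is census-exact and open; its only theorem class so far was `a₃`
INACTIVE (g20).  Here three `a₃`-ACTIVE leaf classes, along the `o`-edge `f = {o, a₁}` at weight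
`q`, from the `a₃`-free chords of MixChordOChords.lean:

* **`dChord_o_edge_of_leaf_root₂`**: `a₃` a leaf at the root `a₂` (weight `r`) — typer-1's
  `PendantRoot.Gc_pendant_root` reads `Gc = (1 − r)·Z·B` with `B = r·J + (1 − r)·I`, and
  `D = (1 − r)·Z`; the `D`-chord is `(1 − q)·B⁰ ≤ B`, the `r`-mixture of the `I`- and `J`-chords;
* **`dChord_o_edge_of_leaf_root₁`**: `a₃` a leaf at the root `a₁` — by the root symmetry (`Gc_swap`,
  `covC_root_swap`) the bracket is `B′ = r·J′ + (1 − r)·I`;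
  **`dChord_o_edge_of_leaf_either_root`** collects both;
* **`dChord_o_edge_of_leaf_o`**: `a₃` a leaf at `o` (weight `r`) — typer-1's `PendantO.Gc_pendant_o`
  reads `Gc = (1 − r)·Z·I` while `D = Z − r·P(Q, o ∈ U)`; the `D`-chord follows from the `I`-chord,
  `I ≥ 0` (BHK) and the monotonicity of `P(o ∈ U | Q)` in the weight of the `o`-edge
  (`Z·P⁰(Q, oU) ≤ Z⁰·P(Q, oU)`, a mediant inequality).

Census (own exact code, data/night-1/g22/): the `D`-chord 0 / 450 for each root, 0 / 300 at `o`.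
The weakening lemmas **`nMixChord_DZ_of_D`**, **`nMixChord_DZ2_of_DZ`**, **`nMixChord_DZ2_of_D`**
(the `D`-chord implies the `D·Z`- and `(D·Z)²`-chords once the closed child has `Gc ≥ 0`: `D`, `Z` do
not increase when the edge opens) turn these into the chain's row literally —
**`dz2Chord_o_edge_of_leaf_either_root`**, **`dz2Chord_o_edge_of_leaf_o`** (`NMixChord normDZ2`,
unconditional: (HCOV) holds on the classes by typer-1's `HCov_pendant_either_root` / `HCov_pendant_o`).
Own code; standard axioms.
-/

namespace Summit.Ventures.PercRepro2

open UnionCluster CovForm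

namespace Mix

section LeafRoot

variable {V : Type*} {E : Type*} [Fintype E] [DecidableEq E] [Fintype V] [DecidableEq V]
  {R : Type*} [Field R] [LinearOrder R] [IsStrictOrderedRing R]

variable (p : E → R) (ends : E → Sym2 V) {o a₁ a₂ a₃ : V} (b : V) {f g : E}

omit [Fintype V] [DecidableEq V] [LinearOrder R] [IsStrictOrderedRing R] in
/-- The cleared covariance is symmetric in the roots (`Q` is). -/
lemma covC_root_swap (a₁ a₂ : V) (X Y : Set (Config E)) :
    PendantRoot.covC p ends a₂ a₁ X Y = PendantRoot.covC p ends a₁ a₂ X Y := by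
  unfold PendantRoot.covC
  rw [avoidAll_root_swap]

omit [Fintype E] [DecidableEq E] [Fintype V] [DecidableEq V] [LinearOrder R] [IsStrictOrderedRing R] in
/-- The leaf edge of `a₃` is not the `o`-edge `{o, a₁}`. -/
lemma leaf_ne_o_edge {x : V} (hf : ends f = s(o, a₁)) (hg : ends g = s(a₃, x))
    (ho : o ≠ a₃) (h31 : a₃ ≠ a₁) : g ≠ f := by
  intro h
  have h3 : a₃ ∈ ends f := by rw [← h, hg]; exact Sym2.mem_mk_left a₃ x
  rw [hf] at h3
  rcases Sym2.mem_iff.1 h3 with h' | h'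
  · exact ho h'.symm
  · exact h31 h'

/-- **The `o`-class `D`-chord along `f = {o, a₁}` when `a₃` is a leaf at the root `a₂`**
(`NMixChord normD`): `Gc = (1 − r)·Z·B` with `B = r·J + (1 − r)·I` (typer-1's `Gc_pendant_root`),
`D = (1 − r)·Z`, and the chord is the `r`-mixture of the `I`-chord and the `J`-chord. -/
theorem dChord_o_edge_of_leaf_root₂ (hp : IsProbVec p) (hf : ends f = s(o, a₁))
    (hg : ends g = s(a₃, a₂)) (hleaf : ∀ e, a₃ ∈ ends e → e = g)
    (h32 : a₃ ≠ a₂) (h31 : a₃ ≠ a₁) (ho : o ≠ a₃) (hb : b ≠ a₃) :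
    NMixChord (normD ends a₁ a₂ a₃) p ends o a₁ a₂ a₃ b f := by
  have hgf : g ≠ f := leaf_ne_o_edge ends hf hg ho h31
  have hp0 : IsProbVec (Function.update p f 0) := hp.update f le_rfl zero_le_one
  have hq1 := hp.le_one f
  have hr0 := hp.nonneg g
  have hr1 := hp.le_one g
  have hc1 := conn_a1_o_of_update_one p ends hf
  have hG1 : Gc (Function.update p f 1) ends o a₁ a₂ a₃ b = 0 :=
    Gc_eq_zero_of_sure_conn_o _ ends o a₃ b hc1
  have hI := iChord p ends (a₂ := a₂) b hp hf
  have hJ := jChord p ends (a₂ := a₂) b hp hf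
  have hZ := prob_nonneg hp (avoidAll ends a₂ {a₁})
  have hZ0 := prob_nonneg hp0 (avoidAll ends a₂ {a₁})
  unfold NMixChord normD
  rw [hG1, mul_zero, sub_zero,
    PendantRoot.Gc_pendant_root p ends hg hleaf h32 h31 ho hb,
    PendantRoot.Gc_pendant_root (Function.update p f 0) ends hg hleaf h32 h31 ho hb,
    PendantRoot.prob_PD p hg hleaf h32 h31, PendantRoot.prob_PD (Function.update p f 0) hg hleaf h32 h31,
    Function.update_of_ne hgf]
  have h1r : 0 ≤ 1 - p g := sub_nonneg.2 hr1
  have hB := add_le_add (mul_le_mul_of_nonneg_left hJ hr0) (mul_le_mul_of_nonneg_left hI h1r)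
  have key := mul_nonneg (mul_nonneg (mul_nonneg (mul_nonneg h1r h1r) hZ) hZ0) (sub_nonneg.2 hB)
  linear_combination key

/-- **The `o`-class `D`-chord along `f = {o, a₁}` when `a₃` is a leaf at the root `a₁`**: by the root
symmetry `Gc_swap` the bracket is `B′ = r·J′ + (1 − r)·I`, and the chord is the `r`-mixture of the
`I`-chord and the `J′`-chord. -/
theorem dChord_o_edge_of_leaf_root₁ (hp : IsProbVec p) (hf : ends f = s(o, a₁))
    (hg : ends g = s(a₃, a₁)) (hleaf : ∀ e, a₃ ∈ ends e → e = g)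
    (h32 : a₃ ≠ a₂) (h31 : a₃ ≠ a₁) (ho : o ≠ a₃) (hb : b ≠ a₃) :
    NMixChord (normD ends a₁ a₂ a₃) p ends o a₁ a₂ a₃ b f := by
  have hgf : g ≠ f := leaf_ne_o_edge ends hf hg ho h31
  have hp0 : IsProbVec (Function.update p f 0) := hp.update f le_rfl zero_le_one
  have hq1 := hp.le_one f
  have hr0 := hp.nonneg g
  have hr1 := hp.le_one g
  have hc1 := conn_a1_o_of_update_one p ends hf
  have hG1 : Gc (Function.update p f 1) ends o a₁ a₂ a₃ b = 0 :=
    Gc_eq_zero_of_sure_conn_o _ ends o a₃ b hc1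
  have hI := iChord p ends (a₂ := a₂) b hp hf
  have hJ := j'Chord p ends (a₂ := a₂) b hp hf
  have hZ := prob_nonneg hp (avoidAll ends a₂ {a₁})
  have hZ0 := prob_nonneg hp0 (avoidAll ends a₂ {a₁})
  unfold NMixChord normD
  rw [hG1, mul_zero, sub_zero, ← Gc_swap p ends o a₁ a₂ a₃ b,
    ← Gc_swap (Function.update p f 0) ends o a₁ a₂ a₃ b,
    PendantRoot.Gc_pendant_root p ends hg hleaf h31 h32 ho hb,
    PendantRoot.Gc_pendant_root (Function.update p f 0) ends hg hleaf h31 h32 ho hb,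
    ← PDEvent_root_swap ends a₁ a₂ a₃,
    PendantRoot.prob_PD p hg hleaf h31 h32, PendantRoot.prob_PD (Function.update p f 0) hg hleaf h31 h32,
    Function.update_of_ne hgf, avoidAll_root_swap ends a₁ a₂]
  simp only [covC_root_swap p ends a₁ a₂, covC_root_swap (Function.update p f 0) ends a₁ a₂]
  have h1r : 0 ≤ 1 - p g := sub_nonneg.2 hr1
  have hB := add_le_add (mul_le_mul_of_nonneg_left hJ hr0) (mul_le_mul_of_nonneg_left hI h1r)
  have key := mul_nonneg (mul_nonneg (mul_nonneg (mul_nonneg h1r h1r) hZ) hZ0) (sub_nonneg.2 hB)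
  linear_combination key

/-- **The `o`-class `D`-chord along `f = {o, a₁}` whenever `a₃` is a leaf at either root.** -/
theorem dChord_o_edge_of_leaf_either_root (hp : IsProbVec p) (hf : ends f = s(o, a₁))
    (hg : ends g = s(a₃, a₂) ∨ ends g = s(a₃, a₁)) (hleaf : ∀ e, a₃ ∈ ends e → e = g)
    (h32 : a₃ ≠ a₂) (h31 : a₃ ≠ a₁) (ho : o ≠ a₃) (hb : b ≠ a₃) :
    NMixChord (normD ends a₁ a₂ a₃) p ends o a₁ a₂ a₃ b f := by
  rcases hg with hg | hg
  · exact dChord_o_edge_of_leaf_root₂ p ends b hp hf hg hleaf h32 h31 ho hb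
  · exact dChord_o_edge_of_leaf_root₁ p ends b hp hf hg hleaf h32 h31 ho hb

omit [Fintype E] [DecidableEq E] [Fintype V] [DecidableEq V] in
/-- Under `Q`, `{o ∈ C₂} ⊆ {o ∈ C₁}ᶜ`. -/
lemma Q_oH_subset_oL_compl (o a₁ a₂ : V) :
    avoidAll ends a₂ {a₁} ∩ connEvent ends a₂ o ⊆ avoidAll ends a₂ {a₁} ∩ (connEvent ends a₁ o)ᶜ := by
  rintro ω ⟨hQ, h2o⟩
  refine ⟨hQ, fun h1o => ?_⟩
  have h21 : Conn ends ω a₂ a₁ := conn_trans h2o (conn_symm h1o)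
  exact (mem_avoidAll.1 hQ) a₁ (Finset.mem_singleton_self a₁) h21

omit [Fintype V] [DecidableEq V] in
/-- `P(Q, oL) + P(Q, oH) ≤ P(Q)`. -/
lemma prob_Q_oL_add_oH_le (hp : IsProbVec p) (o a₁ a₂ : V) :
    prob p (avoidAll ends a₂ {a₁} ∩ connEvent ends a₁ o) +
        prob p (avoidAll ends a₂ {a₁} ∩ connEvent ends a₂ o) ≤ prob p (avoidAll ends a₂ {a₁}) := by
  have e := prob_inter_add_prob_inter_compl p (avoidAll ends a₂ {a₁}) (connEvent ends a₁ o)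
  have h := prob_mono hp (Q_oH_subset_oL_compl ends o a₁ a₂)
  linarith

/-- **The `o`-class `D`-chord along `f = {o, a₁}` when `a₃` is a leaf at `o`**: `Gc = (1 − r)·Z·I`
(`PendantO.Gc_pendant_o`), `D = Z − r·(P(Q, oL) + P(Q, oH))` (`PendantO.prob_PD_o`); the chord
follows from the `I`-chord, `I ≥ 0` (BHK) and `Z·P⁰(Q, oU) ≤ Z⁰·P(Q, oU)` (opening the `o`-edge
raises `P(o ∈ U | Q)`: a mediant, since `P¹(Q, oU) = Z¹`). -/
theorem dChord_o_edge_of_leaf_o (hp : IsProbVec p) (hf : ends f = s(o, a₁))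
    (hg : ends g = s(a₃, o)) (hleaf : ∀ e, a₃ ∈ ends e → e = g)
    (h3o : a₃ ≠ o) (h31 : a₃ ≠ a₁) (h32 : a₃ ≠ a₂) (hb : b ≠ a₃) :
    NMixChord (normD ends a₁ a₂ a₃) p ends o a₁ a₂ a₃ b f := by
  have hgf : g ≠ f := leaf_ne_o_edge ends hf hg h3o.symm h31
  have hp0 : IsProbVec (Function.update p f 0) := hp.update f le_rfl zero_le_one
  have hq0 := hp.nonneg f
  have hq1 := hp.le_one f
  have hr0 := hp.nonneg g
  have hr1 := hp.le_one g
  have hc1 := conn_a1_o_of_update_one p ends hf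
  have hG1 : Gc (Function.update p f 1) ends o a₁ a₂ a₃ b = 0 :=
    Gc_eq_zero_of_sure_conn_o _ ends o a₃ b hc1
  have hI := iChord p ends (a₂ := a₂) b hp hf
  have hI0 : 0 ≤ -2 * PendantRoot.covC p ends a₁ a₂ (connEvent ends a₂ o) (connEvent ends a₁ b) -
      2 * PendantRoot.covC p ends a₁ a₂ (connEvent ends a₁ o) (connEvent ends a₂ b) := by
    have := PendantRoot.covC_cross_nonpos p ends hp o a₁ a₂ b
    linarith [this.1, this.2]
  have hI00 : 0 ≤ -2 * PendantRoot.covC (Function.update p f 0) ends a₁ a₂ (connEvent ends a₂ o)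
      (connEvent ends a₁ b) -
      2 * PendantRoot.covC (Function.update p f 0) ends a₁ a₂ (connEvent ends a₁ o)
        (connEvent ends a₂ b) := by
    have := PendantRoot.covC_cross_nonpos (Function.update p f 0) ends hp0 o a₁ a₂ b
    linarith [this.1, this.2]
  have hD := prob_nonneg hp (PDEvent ends a₁ a₂ a₃)
  have hD0 := prob_nonneg hp0 (PDEvent ends a₁ a₂ a₃)
  have hZ0 := prob_nonneg hp0 (avoidAll ends a₂ {a₁})
  have hZ1 := prob_nonneg (hp.update f zero_le_one le_rfl) (avoidAll ends a₂ {a₁})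
  -- the mediant: `Z · (O⁰ + H⁰) ≤ Z⁰ · (O + H)`
  have hO1 : prob (Function.update p f 1) (avoidAll ends a₂ {a₁} ∩ connEvent ends a₁ o) =
      prob (Function.update p f 1) (avoidAll ends a₂ {a₁}) :=
    prob_inter_conn_eq' _ ends hc1 _
  have hH1 : prob (Function.update p f 1) (avoidAll ends a₂ {a₁} ∩ connEvent ends a₂ o) = 0 :=
    prob_Q_conn₂_eq_zero _ ends hc1
  have hsum := prob_Q_oL_add_oH_le (Function.update p f 0) ends hp0 o a₁ a₂
  have pQ := prob_eq_pin p (avoidAll ends a₂ {a₁}) f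
  have pO := prob_eq_pin p (avoidAll ends a₂ {a₁} ∩ connEvent ends a₁ o) f
  have pH := prob_eq_pin p (avoidAll ends a₂ {a₁} ∩ connEvent ends a₂ o) f
  rw [hO1] at pO
  rw [hH1] at pH
  have hmed : prob p (avoidAll ends a₂ {a₁}) *
      (prob (Function.update p f 0) (avoidAll ends a₂ {a₁} ∩ connEvent ends a₁ o) +
        prob (Function.update p f 0) (avoidAll ends a₂ {a₁} ∩ connEvent ends a₂ o)) ≤
      prob (Function.update p f 0) (avoidAll ends a₂ {a₁}) *
      (prob p (avoidAll ends a₂ {a₁} ∩ connEvent ends a₁ o) +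
        prob p (avoidAll ends a₂ {a₁} ∩ connEvent ends a₂ o)) := by
    rw [pQ, pO, pH]
    nlinarith [mul_nonneg (mul_nonneg hq0 hZ1) (sub_nonneg.2 hsum)]
  unfold NMixChord normD
  rw [hG1, mul_zero, sub_zero,
    PendantO.Gc_pendant_o p ends hg hleaf h3o h31 h32 hb,
    PendantO.Gc_pendant_o (Function.update p f 0) ends hg hleaf h3o h31 h32 hb,
    Function.update_of_ne hgf]
  rw [PendantO.prob_PD_o p hg hleaf h3o h31 h32] at hD ⊢
  rw [PendantO.prob_PD_o (Function.update p f 0) hg hleaf h3o h31 h32, Function.update_of_ne hgf] at hD0 ⊢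
  have h1r : 0 ≤ 1 - p g := sub_nonneg.2 hr1
  have h1 := mul_le_mul_of_nonneg_right hI (mul_nonneg hZ0 hD)
  have h2 := mul_le_mul_of_nonneg_left (mul_le_mul_of_nonneg_left hmed hr0) hI0
  nlinarith [mul_nonneg h1r (sub_nonneg.2 h1), mul_nonneg h1r (sub_nonneg.2 h2)]

end LeafRoot

section Weakening

variable {V : Type*} {E : Type*} [Fintype E] [DecidableEq E] [Fintype V] [DecidableEq V]
  {R : Type*} [Field R] [LinearOrder R] [IsStrictOrderedRing R]

variable {p : E → R} {ends : E → Sym2 V} {o a₁ a₂ a₃ b : V} {e : E}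

omit [Fintype V] [DecidableEq V] in
/-- **`D`-chord ⟹ `D·Z`-chord** when the closed child has `Gc ≥ 0` (`Z` does not increase when
the edge opens). -/
lemma nMixChord_DZ_of_D (hp : IsProbVec p) (hm : NMixChord (normD ends a₁ a₂ a₃) p ends o a₁ a₂ a₃ b e)
    (h0 : 0 ≤ Gc (Function.update p e 0) ends o a₁ a₂ a₃ b) :
    NMixChord (normDZ ends a₁ a₂ a₃) p ends o a₁ a₂ a₃ b e := by
  have hp0 : IsProbVec (Function.update p e 0) := hp.update e le_rfl zero_le_one
  have hZ := EdmRow.prob_le_prob_update_zero_of_isLowerSet hp (EdmRow.isLowerSet_avoidAll ends a₁ a₂) e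
  have hZn := prob_nonneg hp (avoidAll ends a₂ {a₁})
  have hDn := prob_nonneg hp (PDEvent ends a₁ a₂ a₃)
  have h1q : 0 ≤ 1 - p e := sub_nonneg.2 (hp.le_one e)
  unfold NMixChord normD at hm
  unfold NMixChord normDZ
  have hR : 0 ≤ (Gc p ends o a₁ a₂ a₃ b - p e * Gc (Function.update p e 1) ends o a₁ a₂ a₃ b) *
      prob (Function.update p e 0) (PDEvent ends a₁ a₂ a₃) :=
    le_trans (mul_nonneg (mul_nonneg h1q h0) hDn) hm
  have h₁ := mul_le_mul_of_nonneg_right hm hZn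
  have h₂ := mul_le_mul_of_nonneg_left hZ hR
  linear_combination h₁ + h₂

omit [Fintype V] [DecidableEq V] in
/-- **`D·Z`-chord ⟹ `(D·Z)²`-chord** when the closed child has `Gc ≥ 0`. -/
lemma nMixChord_DZ2_of_DZ (hp : IsProbVec p)
    (hm : NMixChord (normDZ ends a₁ a₂ a₃) p ends o a₁ a₂ a₃ b e)
    (h0 : 0 ≤ Gc (Function.update p e 0) ends o a₁ a₂ a₃ b) :
    NMixChord (normDZ2 ends a₁ a₂ a₃) p ends o a₁ a₂ a₃ b e := by
  have hp0 : IsProbVec (Function.update p e 0) := hp.update e le_rfl zero_le_one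
  have hZ := EdmRow.prob_le_prob_update_zero_of_isLowerSet hp (EdmRow.isLowerSet_avoidAll ends a₁ a₂) e
  have hD := EdmRow.prob_le_prob_update_zero_of_isLowerSet hp (EdmRow.isLowerSet_PDEvent ends a₁ a₂ a₃) e
  have hZn := prob_nonneg hp (avoidAll ends a₂ {a₁})
  have hDn := prob_nonneg hp (PDEvent ends a₁ a₂ a₃)
  have h1q : 0 ≤ 1 - p e := sub_nonneg.2 (hp.le_one e)
  unfold NMixChord normDZ at hm
  unfold NMixChord normDZ2
  have hN : 0 ≤ prob p (PDEvent ends a₁ a₂ a₃) * prob p (avoidAll ends a₂ {a₁}) := mul_nonneg hDn hZn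
  have hNle : prob p (PDEvent ends a₁ a₂ a₃) * prob p (avoidAll ends a₂ {a₁}) ≤
      prob (Function.update p e 0) (PDEvent ends a₁ a₂ a₃) *
        prob (Function.update p e 0) (avoidAll ends a₂ {a₁}) :=
    mul_le_mul hD hZ hZn (prob_nonneg hp0 _)
  have hR : 0 ≤ (Gc p ends o a₁ a₂ a₃ b - p e * Gc (Function.update p e 1) ends o a₁ a₂ a₃ b) *
      (prob (Function.update p e 0) (PDEvent ends a₁ a₂ a₃) *
        prob (Function.update p e 0) (avoidAll ends a₂ {a₁})) :=
    le_trans (mul_nonneg (mul_nonneg h1q h0) hN) hm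
  have h₁ := mul_le_mul_of_nonneg_right hm hN
  have h₂ := mul_le_mul_of_nonneg_left hNle hR
  linear_combination h₁ + h₂

omit [Fintype V] [DecidableEq V] in
/-- **`D`-chord ⟹ `(D·Z)²`-chord** when the closed child has `Gc ≥ 0`. -/
lemma nMixChord_DZ2_of_D (hp : IsProbVec p) (hm : NMixChord (normD ends a₁ a₂ a₃) p ends o a₁ a₂ a₃ b e)
    (h0 : 0 ≤ Gc (Function.update p e 0) ends o a₁ a₂ a₃ b) :
    NMixChord (normDZ2 ends a₁ a₂ a₃) p ends o a₁ a₂ a₃ b e :=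
  nMixChord_DZ2_of_DZ hp (nMixChord_DZ_of_D hp hm h0) h0

end Weakening

section Corollaries

variable {V : Type*} {E : Type*} [Fintype E] [DecidableEq E] [Fintype V] [DecidableEq V]
  {R : Type*} [Field R] [LinearOrder R] [IsStrictOrderedRing R]

variable (p : E → R) (ends : E → Sym2 V) {o a₁ a₂ a₃ : V} (b : V) {f g : E}

/-- **The chain's row — the `(D·Z)²`-chord — along `{o, a₁}` whenever `a₃` is a leaf at either
root** (unconditional: (HCOV) holds on the class by typer-1's `HCov_pendant_either_root`). -/
theorem dz2Chord_o_edge_of_leaf_either_root (hp : IsProbVec p) (hf : ends f = s(o, a₁))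
    (hg : ends g = s(a₃, a₂) ∨ ends g = s(a₃, a₁)) (hleaf : ∀ e, a₃ ∈ ends e → e = g)
    (h32 : a₃ ≠ a₂) (h31 : a₃ ≠ a₁) (ho : o ≠ a₃) (hb : b ≠ a₃) :
    NMixChord (normDZ2 ends a₁ a₂ a₃) p ends o a₁ a₂ a₃ b f :=
  nMixChord_DZ2_of_D hp (dChord_o_edge_of_leaf_either_root p ends b hp hf hg hleaf h32 h31 ho hb)
    (PendantRoot.HCov_pendant_either_root (Function.update p f 0) (hp.update f le_rfl zero_le_one)
      ends hleaf hg h31 h32 ho hb)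

/-- **The chain's row along `{o, a₁}` whenever `a₃` is a leaf at `o`** (unconditional:
typer-1's `HCov_pendant_o`). -/
theorem dz2Chord_o_edge_of_leaf_o (hp : IsProbVec p) (hf : ends f = s(o, a₁))
    (hg : ends g = s(a₃, o)) (hleaf : ∀ e, a₃ ∈ ends e → e = g)
    (h3o : a₃ ≠ o) (h31 : a₃ ≠ a₁) (h32 : a₃ ≠ a₂) (hb : b ≠ a₃) :
    NMixChord (normDZ2 ends a₁ a₂ a₃) p ends o a₁ a₂ a₃ b f :=
  nMixChord_DZ2_of_D hp (dChord_o_edge_of_leaf_o p ends b hp hf hg hleaf h3o h31 h32 hb)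
    (PendantO.HCov_pendant_o (Function.update p f 0) ends (hp.update f le_rfl zero_le_one) hg hleaf
      h3o h31 h32 hb)

end Corollaries

end Mix

end Summit.Ventures.PercRepro2
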